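import Mathlib

/-!
# The rank identity behind the FR / FL certificates (negative-side linear-algebra lemma for the crux
`SubgroupIdentityDesigns`, stmt-MatrixMultiplication-14079; cell B2b-5, gen 7 — report
`run/shared/lean/b2b/levelgraded-cu/ORACLE-g7.md` §G7-1, filters FR and FL)

Let `V` be a subspace of the functions `S → K` on a finite set `S` and `T ⊆ S` a finset such that every delta
function `δ_x = Pi.single x 1`, `x ∈ T`, lies in `V`.  Then restriction to the complement of `T` has kernel
exactly the span of those deltas, so
`finrank V = |T| + finrank (V restricted to S ∖ T)` (`finrank_eq_card_add_finrank_restrict`), and in particular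
`|T| + finrank (V|_{S ∖ T}) ≤ finrank V₀` for any `V ≤ V₀` (`card_add_finrank_restrict_le`).
In the census (`(m,k) = (2,1)`, `S = H₁H₂H₃`, `V = F₁|_S` = the row space of the 0/1 fibre-indicator matrix
`M_S`, `T = H₁H₃`): a level-one identity design puts every `δ_x`, `x ∈ H₁H₃`, into `F₁|_S`
(`DesignTranslate.levelOne_design_translate`), hence  `rank_ℚ M_S = |H₁H₃| + rank_ℚ M_{S∖H₁H₃}`.  The FR certificate
bounds the left side above by `dim F₁|_{GL₂} = 1418` and the right side below by a GF(2) rank; the FL certificate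
bounds the left side above by `1440 - k` with `k` explicit integer left-kernel vectors of `M_S`.
Sorry-free.  VALUE = soundness lemma for a certificate format, NOT summit progress.
-/

set_option linter.dupNamespace false

open scoped BigOperators Classical

namespace Summit.MatrixMultiplication.MatrixMultiplication.Theorems.SubgroupIdentityDesigns.Negative

namespace RankSplit

variable {K : Type*} [Field K] {S : Type*} [Fintype S] [DecidableEq S]

omit [Fintype S] in
/-- A function vanishing off `T` is the combination of the deltas on `T` with its own values. -/
theorem eq_sum_single_of_support_subset (T : Finset S) (g : S → K) (hg : ∀ s, s ∉ T → g s = 0) :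
    g = ∑ x ∈ T, g x • (Pi.single x (1 : K) : S → K) := by
  funext s
  simp only [Finset.sum_apply, Pi.smul_apply, Pi.single_apply, smul_eq_mul, mul_ite, mul_one, mul_zero]
  rw [Finset.sum_ite_eq]
  by_cases hs : s ∈ T
  · simp [hs]
  · simp [hs, hg s hs]

/-- The deltas `δ_x`, `x ∈ T`, are linearly independent. -/
theorem linearIndependent_single (T : Finset S) :
    LinearIndependent K (fun x : T => (Pi.single (x : S) (1 : K) : S → K)) := by
  have h := (Pi.basisFun K S).linearIndependent.comp ((↑) : T → S) Subtype.val_injective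
  simpa [Function.comp_def, Pi.basisFun_apply] using h

omit [Fintype S] in
/-- `V ⊓ ker(restriction off T)` is the span of the deltas on `T`, when those deltas lie in `V`. -/
theorem inf_ker_restrict_eq_span (T : Finset S) (V : Submodule K (S → K))
    (hT : ∀ x ∈ T, (Pi.single x (1 : K) : S → K) ∈ V) :
    V ⊓ LinearMap.ker (LinearMap.funLeft K K ((↑) : {s : S // s ∉ T} → S)) =
      Submodule.span K (Set.range fun x : T => (Pi.single (x : S) (1 : K) : S → K)) := by
  apply le_antisymm
  · rintro g ⟨hgV, hgker⟩
    have hg : ∀ s, s ∉ T → g s = 0 := by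
      intro s hs
      have := congrFun (LinearMap.mem_ker.mp hgker) ⟨s, hs⟩
      simpa [LinearMap.funLeft_apply] using this
    rw [eq_sum_single_of_support_subset T g hg]
    refine Submodule.sum_mem _ fun x hx => Submodule.smul_mem _ _ ?_
    exact Submodule.subset_span ⟨⟨x, hx⟩, rfl⟩
  · rw [Submodule.span_le]
    rintro _ ⟨x, rfl⟩
    refine ⟨hT x x.2, ?_⟩
    show _ ∈ LinearMap.ker _
    rw [LinearMap.mem_ker]
    funext s
    have : (s : S) ≠ x := fun h => s.2 (h ▸ x.2)
    simp [LinearMap.funLeft_apply, this]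

/-- RANK IDENTITY.  If `V ≤ (S → K)` contains every delta `δ_x`, `x ∈ T`, then
`finrank V = |T| + finrank (V restricted to S ∖ T)`. -/
theorem finrank_eq_card_add_finrank_restrict (T : Finset S) (V : Submodule K (S → K))
    (hT : ∀ x ∈ T, (Pi.single x (1 : K) : S → K) ∈ V) :
    Module.finrank K V =
      T.card + Module.finrank K (V.map (LinearMap.funLeft K K ((↑) : {s : S // s ∉ T} → S))) := by
  set ρ := LinearMap.funLeft K K ((↑) : {s : S // s ∉ T} → S) with hρ
  have hrn := LinearMap.finrank_range_add_finrank_ker (ρ.domRestrict V)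
  have hrange : LinearMap.range (ρ.domRestrict V) = V.map ρ := by
    rw [show ρ.domRestrict V = ρ.comp V.subtype from rfl, LinearMap.range_comp, Submodule.range_subtype]
  have hker : (LinearMap.ker (ρ.domRestrict V)).map V.subtype = V ⊓ LinearMap.ker ρ := by
    ext g
    simp only [Submodule.mem_map, LinearMap.mem_ker, LinearMap.domRestrict_apply, Submodule.coe_subtype,
      Submodule.mem_inf]
    constructor
    · rintro ⟨v, hv, rfl⟩
      exact ⟨v.2, hv⟩
    · rintro ⟨hgV, hg⟩
      exact ⟨⟨g, hgV⟩, hg, rfl⟩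
  have hkdim : Module.finrank K (LinearMap.ker (ρ.domRestrict V)) = T.card := by
    rw [← Submodule.finrank_map_subtype_eq V (LinearMap.ker (ρ.domRestrict V)), hker,
      inf_ker_restrict_eq_span T V hT, finrank_span_eq_card (linearIndependent_single T), Fintype.card_coe]
  rw [hrange, hkdim] at hrn
  omega

/-- The inequality form used by the certificates: `|T| + finrank (V|_{S∖T}) ≤ finrank V₀` whenever `V ≤ V₀`. -/
theorem card_add_finrank_restrict_le (T : Finset S) (V V₀ : Submodule K (S → K)) (hV : V ≤ V₀)
    (hT : ∀ x ∈ T, (Pi.single x (1 : K) : S → K) ∈ V) :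
    T.card + Module.finrank K (V.map (LinearMap.funLeft K K ((↑) : {s : S // s ∉ T} → S))) ≤
      Module.finrank K V₀ := by
  rw [← finrank_eq_card_add_finrank_restrict T V hT]
  exact Submodule.finrank_mono hV

end RankSplit

end Summit.MatrixMultiplication.MatrixMultiplication.Theorems.SubgroupIdentityDesigns.Negative
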